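import Literature.AlgebraicGeometry.Resolution.QuadraticTransformSurjection
import HarnessLib

/-!
# The `δ`-invariant drops under a quadratic transform of a reduced one-dimensional local ring

Topic: `Literature/AlgebraicGeometry/Resolution`. Conclusion of the ring-theoretic core of
Kollár 2007, Thm. 1.101 (3) ⇒ (1) [Kru30, Satz 7] for REDUCED local rings (files
`QuadraticTransformNormalization.lean`, `QuadraticTransformSurjection.lean`): with the data there
(`(R, 𝔪)` reduced Noetherian local of dimension one, `K` its total ring of fractions, `R̄`
module-finite, `c ∈ 𝔪` a non-zero-divisor, `𝔪/c ⊆ B ⊆ ⋃ 𝔪ⁿ/cⁿ`, `𝔴 ⊆ B` a prime over `𝔪`,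
`R' = B_𝔴`, `Q' = K_𝔴`, `R̄'` the integral closure of `R'` in `Q'`):

* `QuadraticTransform.module_finite_integralClosure` — `R̄'` is a finite `R'`-module;
* `QuadraticTransform.exists_witness` — if `𝔪` is not principal and `R ≠ R̄`, there is
  `n ∈ R̄ ∖ R` with `c n ∈ 𝔪` (Lemma 1.99: `B R ≠ R` unless `R` is regular);
* `length_normalizationQuotient_ne_top` — `δ(R) = length_R(R̄/R) < ∞` (reduced case);
* `QuadraticTransform.length_quotient_lt` — **`δ(R') < δ(R)`**: the map `R̄ → R̄'/R'` is
  surjective (`exists_sub_mem_of_pow` and `c^M R̄' ⊆ R'`), its kernel contains `R` and the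
  witness, and lengths over `R'` are dominated by lengths over `R`;

No definitions, no named facts. Source: J. Kollár, *Lectures on Resolution of Singularities*
(2007), §1.13, Thm. 1.101, Lemma 1.99 [Kollar2007].
-/

noncomputable section

open IsLocalRing Polynomial nonZeroDivisors

namespace Literature.AlgebraicGeometry.Resolution

universe u

/-! ## Lengths -/

section Length

variable {A : Type u} [CommRing A] {M : Type u} [AddCommGroup M] [Module A M]

/-- Lengths can only grow under restriction of scalars. [cite: Kollar2007, Thm. 1.101] -/
private theorem length_le_length_restrictScalars_aux (B : Type u) [CommRing B] [Algebra A B]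
    [Module B M] [IsScalarTower A B M] : Module.length B M ≤ Module.length A M := by
  have h := Submodule.length_le_length_restrictScalars (A := A) (⊤ : Submodule B M)
  rw [Submodule.restrictScalars_top] at h
  rwa [Submodule.topEquiv.length_eq, Submodule.topEquiv.length_eq] at h

/-- Additivity of length along `p ≤ q ≤ M`: `ℓ(M/p) = ℓ(q/p) + ℓ(M/q)`.
[cite: Kollar2007, Thm. 1.101] -/
private theorem length_quotient_eq_add_aux {p q : Submodule A M} (h : p ≤ q) :
    Module.length A (M ⧸ p) =
      Module.length A (q.map p.mkQ) + Module.length A (M ⧸ q) := by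
  rw [Module.length_eq_add_of_exact (q.map p.mkQ).subtype (q.map p.mkQ).mkQ
    (Submodule.injective_subtype _) (Submodule.mkQ_surjective _) (LinearMap.exact_subtype_mkQ _),
    (Submodule.quotientQuotientEquivQuotient p q h).length_eq]

end Length

/-! ## `δ(R) < ∞` for a reduced one-dimensional local ring -/

section Finite

/-- **`δ(R) < ∞`**: for a reduced Noetherian local ring `R` of dimension one with module-finite
normalization `R̄ ⊆ K`, the `R`-module `R̄/R` has finite length (it is a finitely generated
module over the Artinian ring `R/(d)`, `d` a non-zero-divisor in the conductor).
[cite: Kollar2007, Thm. 1.101] -/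
theorem length_normalizationQuotient_ne_top (R : Type u) [CommRing R] [IsLocalRing R]
    [IsNoetherianRing R] (K : Type u) [CommRing K] [Algebra R K] [IsFractionRing R K]
    (hdim : ringKrullDim R = 1) [Module.Finite R (integralClosure R K)] :
    Module.length R (↥(integralClosure R K) ⧸
      LinearMap.range (Algebra.linearMap R ↥(integralClosure R K))) ≠ ⊤ := by
  classical
  set N := integralClosure R K with hN
  set P : Submodule R N := LinearMap.range (Algebra.linearMap R N) with hP
  obtain ⟨d, hd0, hd⟩ := exists_mem_nonZeroDivisors_forall_mul_mem_range R K
  obtain ⟨n, hn⟩ := exists_pow_maximalIdeal_le_span_of_mem_nonZeroDivisors R hdim.le hd0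
  have hfin : IsFiniteLength R (R ⧸ Ideal.span {d}) :=
    Matsumura1987.isFiniteLength_quotient_of_pow_le hn
  haveI : IsArtinian R (R ⧸ Ideal.span {d}) :=
    ((isFiniteLength_iff_isNoetherian_isArtinian).mp hfin).2
  haveI : IsArtinianRing (R ⧸ Ideal.span {d}) := isArtinian_of_tower R inferInstance
  have htors : Module.IsTorsionBySet R (N ⧸ P) (Ideal.span {d} : Set R) := by
    rw [Module.isTorsionBySet_span_singleton_iff]
    intro q
    obtain ⟨w, rfl⟩ := Submodule.mkQ_surjective _ q
    rw [Submodule.mkQ_apply, ← Submodule.Quotient.mk_smul, Submodule.Quotient.mk_eq_zero]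
    obtain ⟨r, hr⟩ := hd (w : K) w.2
    refine ⟨r, Subtype.ext ?_⟩
    change algebraMap R K r = ((d • w : N) : K)
    rw [hr, Subalgebra.coe_smul, Algebra.smul_def]
  letI : Module (R ⧸ Ideal.span {d}) (N ⧸ P) := htors.module
  haveI : IsScalarTower R (R ⧸ Ideal.span {d}) (N ⧸ P) := htors.isScalarTower
  haveI : Module.Finite (R ⧸ Ideal.span {d}) (N ⧸ P) :=
    Module.Finite.of_restrictScalars_finite R _ _
  haveI : IsArtinian R (N ⧸ P) :=
    isArtinian_of_surjective_algebraMap (R := R ⧸ Ideal.span {d}) (S := R)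
      Ideal.Quotient.mk_surjective
  haveI : IsNoetherian R (N ⧸ P) := isNoetherian_of_isNoetherianRing_of_finite R _
  exact Module.length_ne_top

end Finite

namespace QuadraticTransform

variable {R : Type u} [CommRing R] [IsLocalRing R] [IsNoetherianRing R] [IsReduced R]
  {K : Type u} [CommRing K] [Algebra R K] [IsFractionRing R K]
  {B : Subalgebra R K} (𝔴 : Ideal B) [𝔴.IsPrime]
  (R' : Type u) [CommRing R'] [Algebra B R'] [IsLocalization.AtPrime R' 𝔴]
  [Algebra R R']
  (Q' : Type u) [CommRing Q'] [Algebra K Q']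
  [IsLocalization (𝔴.primeCompl.map (algebraMap B K)) Q']
  [Algebra R' Q'] [Algebra R Q'] [IsScalarTower B R' Q'] [IsScalarTower R K Q']
  [IsScalarTower R R' Q']

include 𝔴 R' Q'

/-! ## Finiteness of `R̄'` -/

/-- **The integral closure `R̄'` of the quadratic transform `R'` in its total ring of fractions
is a finite `R'`-module**, generated by the image of `R̄`. [cite: Kollar2007, Thm. 1.101] -/
theorem module_finite_integralClosure (hdim : ringKrullDim R = 1)
    [Module.Finite R (integralClosure R K)] [IsNoetherianRing B]
    {c : R} (hc : c ∈ maximalIdeal R) (hc0 : c ∈ R⁰)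
    (hB1 : ∀ m ∈ maximalIdeal R, ∃ b ∈ B, algebraMap R K m = algebraMap R K c * b)
    (hB2 : ∀ b ∈ B, ∃ n : ℕ, ∃ m ∈ maximalIdeal R ^ n,
      algebraMap R K (c ^ n) * b = algebraMap R K m) :
    Module.Finite R' (integralClosure R' Q') := by
  classical
  set N := integralClosure R K with hN
  set lam := algebraMap K Q' with hlam
  haveI : IsNoetherianRing R' := IsLocalization.isNoetherianRing 𝔴.primeCompl R' inferInstance
  obtain ⟨T, hT⟩ := Module.Finite.fg_top (R := R) (M := N)
  -- the span of the images of the generators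
  set S₀ : Submodule R' Q' := Submodule.span R' ((fun t : N => lam (t : K)) '' (T : Set N))
    with hS₀
  have hS₀fg : S₀.FG := Submodule.fg_span ((T.finite_toSet).image _)
  -- `λ(N) ⊆ S₀`
  have hNS₀ : ∀ n : N, lam (n : K) ∈ S₀ := by
    intro n
    have hn : n ∈ Submodule.span R (T : Set N) := by rw [hT]; trivial
    induction hn using Submodule.span_induction with
    | mem t ht => exact Submodule.subset_span ⟨t, ht, rfl⟩
    | zero => simp
    | add x y _ _ hx hy => rw [Subalgebra.coe_add, map_add]; exact S₀.add_mem hx hy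
    | smul r x _ hx =>
      rw [Subalgebra.coe_smul, Algebra.smul_def, map_mul, hlam,
        ← IsScalarTower.algebraMap_apply, IsScalarTower.algebraMap_apply R R' Q',
        ← Algebra.smul_def]
      exact S₀.smul_mem _ hx
  -- the integral closure lies in `S₀`
  have hle : Subalgebra.toSubmodule (integralClosure R' Q') ≤ S₀ := by
    intro x hx
    have hx' : x ∈ Subalgebra.toSubmodule (Algebra.adjoin R' (lam '' (N : Set K))) :=
      integralClosure_le_adjoin 𝔴 R' Q' hdim hc hc0 hB1 hB2 hx
    rw [Algebra.adjoin_eq_span] at hx'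
    have hclos : (Submonoid.closure (lam '' (N : Set K)) : Set Q') = lam '' (N : Set K) := by
      have : lam '' (N : Set K) = (N.toSubmonoid.map (lam : K →* Q') : Set Q') := by
        ext; simp
      rw [this, Submonoid.closure_eq]
    rw [hclos] at hx'
    refine (Submodule.span_le.mpr ?_) hx'
    rintro _ ⟨n, hn, rfl⟩
    exact hNS₀ ⟨n, hn⟩
  haveI : IsNoetherian R' S₀ := isNoetherian_of_fg_of_noetherian _ hS₀fg
  have hfg : (Subalgebra.toSubmodule (integralClosure R' Q')).FG := by
    have := (isNoetherian_of_le hle)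
    exact Module.Finite.iff_fg.mp (by
      haveI : IsNoetherian R' (Subalgebra.toSubmodule (integralClosure R' Q')) :=
        isNoetherian_of_le hle
      infer_instance)
  exact Module.Finite.iff_fg.mpr hfg




/-! ## The witness `n ∈ R̄ ∖ R` with `c n ∈ 𝔪` -/

omit 𝔴 R' Q' [𝔴.IsPrime] [IsLocalization.AtPrime R' 𝔴]
  [IsLocalization (𝔴.primeCompl.map (algebraMap B K)) Q'] [Algebra R R'] [Algebra R Q']
  [IsScalarTower B R' Q'] [IsScalarTower R K Q'] [IsScalarTower R R' Q'] [Algebra B R']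
  [CommRing R'] [CommRing Q'] [Algebra K Q'] [Algebra R' Q'] [IsReduced R] in
/-- **Lemma 1.99 in element form**: if `𝔪` is not principal and `R̄ ≠ R`, there is `n ∈ R̄ ∖ R`
with `c n ∈ 𝔪`: take `n₀ ∈ R̄ ∖ R`, the least `k` with `cᵏ n₀ ∈ R` (`c^M R̄ ⊆ R`) and
`n = c^{k-1} n₀`; if `c n` were a unit of `R`, then `c⁻¹ ∈ R̄`, `𝔪/c ⊆ R̄`, and either some
`m/c ∉ R` works or `𝔪 = (c)`. [cite: Kollar2007, Lemma 1.99] -/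
theorem exists_witness (hdim : ringKrullDim R = 1) [Module.Finite R (integralClosure R K)]
    {c : R} (hc : c ∈ maximalIdeal R) (hc0 : c ∈ R⁰)
    (hnp : ∀ x : R, maximalIdeal R ≠ Ideal.span {x})
    (hN : ∃ n ∈ integralClosure R K, n ∉ Set.range (algebraMap R K)) :
    ∃ n ∈ integralClosure R K, n ∉ Set.range (algebraMap R K) ∧
      ∃ m ∈ maximalIdeal R, algebraMap R K c * n = algebraMap R K m := by
  classical
  set N := integralClosure R K with hN'
  have hcK : IsUnit (algebraMap R K c) := IsLocalization.map_units K ⟨c, hc0⟩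
  -- if `c y = 1` for some `y ∈ R̄`, conclude directly
  have hinv : ∀ y ∈ N, algebraMap R K c * y = 1 →
      ∃ n ∈ N, n ∉ Set.range (algebraMap R K) ∧
        ∃ m ∈ maximalIdeal R, algebraMap R K c * n = algebraMap R K m := by
    intro y hy hcy
    by_contra hcon
    push Not at hcon
    apply hnp c
    refine le_antisymm ?_ ((Ideal.span_singleton_le_iff_mem _).mpr hc)
    intro m hm
    -- `n = y m` has `c n = m`
    have h1 : algebraMap R K c * (y * algebraMap R K m) = algebraMap R K m := by
      rw [← mul_assoc, hcy, one_mul]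
    by_cases hmem : y * algebraMap R K m ∈ Set.range (algebraMap R K)
    · obtain ⟨r, hr⟩ := hmem
      rw [← hr, ← map_mul] at h1
      have := IsFractionRing.injective R K h1
      exact Ideal.mem_span_singleton'.mpr ⟨r, by rw [mul_comm]; exact this⟩
    · exact absurd h1 (hcon _ (N.mul_mem hy (N.algebraMap_mem m)) hmem m hm)
  obtain ⟨n₀, hn₀N, hn₀⟩ := hN
  obtain ⟨M, hM⟩ := exists_pow_mul_mem_range (K := K) hdim hc
  -- the least `k` with `cᵏ n₀ ∈ R`
  have hex : ∃ k : ℕ, algebraMap R K (c ^ k) * n₀ ∈ Set.range (algebraMap R K) :=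
    ⟨M, by obtain ⟨r, hr⟩ := hM n₀ hn₀N; exact ⟨r, hr⟩⟩
  set k := Nat.find hex with hk
  have hk1 : algebraMap R K (c ^ k) * n₀ ∈ Set.range (algebraMap R K) := Nat.find_spec hex
  have hk0 : k ≠ 0 := by
    intro h0
    rw [h0, pow_zero, map_one, one_mul] at hk1
    exact hn₀ hk1
  obtain ⟨j, hj⟩ : ∃ j, k = j + 1 := ⟨k - 1, by omega⟩
  have hjlt : ¬ algebraMap R K (c ^ j) * n₀ ∈ Set.range (algebraMap R K) :=
    Nat.find_min hex (by omega)
  set n := algebraMap R K (c ^ j) * n₀ with hn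
  have hnN : n ∈ N := N.mul_mem (N.algebraMap_mem _) hn₀N
  obtain ⟨r, hr⟩ := hk1
  have hcn : algebraMap R K c * n = algebraMap R K r := by
    rw [hr, hn, ← mul_assoc, ← map_mul, ← pow_succ', ← hj]
  by_cases hrm : r ∈ maximalIdeal R
  · exact ⟨n, hnN, hjlt, r, hrm, hcn⟩
  · -- `r` is a unit, so `c⁻¹ ∈ R̄`
    have hru : IsUnit r := by
      by_contra h; exact hrm ((IsLocalRing.mem_maximalIdeal _).mpr h)
    obtain ⟨r', hr'⟩ := hru.exists_right_inv
    refine hinv (n * algebraMap R K r') (N.mul_mem hnN (N.algebraMap_mem _)) ?_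
    rw [← mul_assoc, hcn, ← map_mul, hr', map_one]

/-! ## The `δ`-invariant drops -/

/-- `c^M R̄' ⊆ R'`: elements of `R̄' = R'·λ(R̄)` multiplied by `c^M` land in the image of `R'`,
since `c^M R̄ ⊆ R`. [cite: Kollar2007, Thm. 1.101] -/
theorem pow_mul_mem_range (hdim : ringKrullDim R = 1) [Module.Finite R (integralClosure R K)]
    {c : R} (hc : c ∈ maximalIdeal R) (hc0 : c ∈ R⁰)
    (hB1 : ∀ m ∈ maximalIdeal R, ∃ b ∈ B, algebraMap R K m = algebraMap R K c * b)
    (hB2 : ∀ b ∈ B, ∃ n : ℕ, ∃ m ∈ maximalIdeal R ^ n,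
      algebraMap R K (c ^ n) * b = algebraMap R K m) :
    ∃ M : ℕ, ∀ z ∈ integralClosure R' Q',
      algebraMap R Q' (c ^ M) * z ∈ Set.range (algebraMap R' Q') := by
  classical
  set N := integralClosure R K with hN
  set lam := algebraMap K Q' with hlam
  obtain ⟨M, hM⟩ := exists_pow_mul_mem_range (K := K) hdim hc
  refine ⟨M, fun z hz => ?_⟩
  have hz' : z ∈ Subalgebra.toSubmodule (Algebra.adjoin R' (lam '' (N : Set K))) :=
    integralClosure_le_adjoin 𝔴 R' Q' hdim hc hc0 hB1 hB2 hz
  rw [Algebra.adjoin_eq_span] at hz'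
  have hclos : (Submonoid.closure (lam '' (N : Set K)) : Set Q') = lam '' (N : Set K) := by
    have : lam '' (N : Set K) = (N.toSubmonoid.map (lam : K →* Q') : Set Q') := by
      ext; simp
    rw [this, Submonoid.closure_eq]
  rw [hclos] at hz'
  refine Submodule.span_induction (p := fun z _ =>
      algebraMap R Q' (c ^ M) * z ∈ Set.range (algebraMap R' Q')) ?_ ?_ ?_ ?_ hz'
  · rintro _ ⟨n, hn, rfl⟩
    obtain ⟨r, hr⟩ := hM n hn
    refine ⟨algebraMap R R' r, ?_⟩
    rw [← IsScalarTower.algebraMap_apply, IsScalarTower.algebraMap_apply R K Q', hr, map_mul,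
      ← IsScalarTower.algebraMap_apply]
  · exact ⟨0, by simp⟩
  · rintro x y - - ⟨a, ha⟩ ⟨b, hb⟩
    exact ⟨a + b, by rw [map_add, ha, hb, mul_add]⟩
  · rintro r x - ⟨a, ha⟩
    exact ⟨r * a, by rw [map_mul, ha, Algebra.smul_def, mul_left_comm]⟩

/-- **The `δ`-invariant drops under a quadratic transform** (Kollár Thm. 1.101, the step
`length(S̄/B S) < length(S̄/S)` for a non-regular `S`, in local and reduced form): if `𝔪` is not
principal and `R̄ ≠ R`, then `length_{R'}(R̄'/R') < length_R(R̄/R)`. The `R`-linear map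
`R̄ → R̄'/R'`, `n ↦ λ(n)`, is surjective (`exists_sub_mem_of_pow`, `c^M R̄' ⊆ R'`); its kernel
contains `R` and the witness `n ∈ R̄ ∖ R` with `c n ∈ 𝔪` (so `n ∈ 𝔪/c ⊆ B ⊆ R'`); and
`length_{R'} ≤ length_R`. [cite: Kollar2007, Thm. 1.101] -/
theorem length_quotient_lt [IsScalarTower R B R'] (hdim : ringKrullDim R = 1)
    [Module.Finite R (integralClosure R K)]
    {c : R} (hc : c ∈ maximalIdeal R) (hc0 : c ∈ R⁰)
    (hB1 : ∀ m ∈ maximalIdeal R, ∃ b ∈ B, algebraMap R K m = algebraMap R K c * b)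
    (hB2 : ∀ b ∈ B, ∃ n : ℕ, ∃ m ∈ maximalIdeal R ^ n,
      algebraMap R K (c ^ n) * b = algebraMap R K m)
    (hnp : ∀ x : R, maximalIdeal R ≠ Ideal.span {x})
    (hN : ∃ n ∈ integralClosure R K, n ∉ Set.range (algebraMap R K)) :
    Module.length R' (↥(integralClosure R' Q') ⧸
        LinearMap.range (Algebra.linearMap R' ↥(integralClosure R' Q'))) <
      Module.length R (↥(integralClosure R K) ⧸
        LinearMap.range (Algebra.linearMap R ↥(integralClosure R K))) := by
  classical
  set N := integralClosure R K with hN'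
  set N' := integralClosure R' Q' with hN''
  set lam := algebraMap K Q' with hlam
  set P : Submodule R N := LinearMap.range (Algebra.linearMap R N) with hP
  set P' : Submodule R' N' := LinearMap.range (Algebra.linearMap R' N') with hP'
  have hNN' : ∀ n ∈ N, lam n ∈ N' := fun n hn =>
    adjoin_le_integralClosure R' Q' (Algebra.subset_adjoin ⟨n, hn, rfl⟩)
  have hlamB : ∀ b : B, lam (b : K) = algebraMap R' Q' (algebraMap B R' b) := fun b => by
    rw [← IsScalarTower.algebraMap_apply B R' Q' b]; rfl
  -- the `R`-linear map `θ : R̄ → R̄'`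
  let θ : N →ₗ[R] N' :=
    { toFun := fun n => ⟨lam n, hNN' n n.2⟩
      map_add' := fun x y => Subtype.ext (by simp)
      map_smul' := fun r x => Subtype.ext (by
        change lam ((r • x : N) : K) = ((r • (⟨lam x, hNN' x x.2⟩ : N') : N') : Q')
        rw [Subalgebra.coe_smul, Subalgebra.coe_smul, Algebra.smul_def, Algebra.smul_def,
          map_mul]
        change lam (algebraMap R K r) * lam (x : K) = algebraMap R Q' r * lam (x : K)
        rw [IsScalarTower.algebraMap_apply R K Q' r]) }
  have hθ : ∀ n : N, ((θ n : N') : Q') = lam n := fun n => rfl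
  let φ : N →ₗ[R] N' ⧸ P' := (P'.mkQ.restrictScalars R).comp θ
  have hφ : ∀ n : N, φ n = P'.mkQ (θ n) := fun n => rfl
  -- membership in `P'` from membership of the value in the image of `R'`
  have hP'mem : ∀ y : N', (y : Q') ∈ Set.range (algebraMap R' Q') → y ∈ P' := by
    rintro y ⟨r, hr⟩
    exact ⟨r, Subtype.ext hr⟩
  -- (1) `φ` is surjective
  obtain ⟨M, hM⟩ := pow_mul_mem_range 𝔴 R' Q' hdim hc hc0 hB1 hB2
  have hsurj : Function.Surjective φ := by
    intro q
    obtain ⟨y, rfl⟩ := Submodule.mkQ_surjective _ q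
    obtain ⟨n, hn, z, hz, hy⟩ := exists_sub_mem_of_pow 𝔴 R' Q' hdim hc hc0 hB1 hB2 M y y.2
    refine ⟨⟨n, hn⟩, ?_⟩
    rw [hφ]
    change P'.mkQ (θ ⟨n, hn⟩) = P'.mkQ y
    rw [← sub_eq_zero, ← map_sub, Submodule.mkQ_apply, Submodule.Quotient.mk_eq_zero]
    refine hP'mem _ ?_
    change ((θ ⟨n, hn⟩ : N') : Q') - y ∈ _
    rw [hθ, hy]
    obtain ⟨r, hr⟩ := hM z hz
    exact ⟨-r, by rw [map_neg, hr]; ring⟩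
  -- (2) the kernel contains `P` and a witness outside `P`
  have hPker : P ≤ LinearMap.ker φ := by
    rintro _ ⟨r, rfl⟩
    rw [LinearMap.mem_ker, hφ, Submodule.mkQ_apply, Submodule.Quotient.mk_eq_zero]
    refine hP'mem _ ⟨algebraMap R R' r, ?_⟩
    rw [hθ, ← IsScalarTower.algebraMap_apply, IsScalarTower.algebraMap_apply R K Q']
    rfl
  obtain ⟨n₁, hn₁N, hn₁, m, hm, hcn₁⟩ := exists_witness (K := K) hdim hc hc0 hnp hN
  have hn₁ker : (⟨n₁, hn₁N⟩ : N) ∈ LinearMap.ker φ := by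
    rw [LinearMap.mem_ker, hφ, Submodule.mkQ_apply, Submodule.Quotient.mk_eq_zero]
    obtain ⟨b, hb, hmb⟩ := hB1 m hm
    have hcK : IsUnit (algebraMap R K c) := IsLocalization.map_units K ⟨c, hc0⟩
    have hn₁b : n₁ = b := hcK.mul_right_injective (hcn₁.trans hmb)
    refine hP'mem _ ⟨algebraMap B R' ⟨b, hb⟩, ?_⟩
    rw [hθ, ← hlamB]
    change lam b = lam n₁
    rw [hn₁b]
  have hn₁P : (⟨n₁, hn₁N⟩ : N) ∉ P := by
    rintro ⟨r, hr⟩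
    exact hn₁ ⟨r, by have := congrArg (fun x : N => (x : K)) hr; simpa using this⟩
  -- (3) lengths
  have hfin := length_normalizationQuotient_ne_top R K hdim
  have h1 : Module.length R' (N' ⧸ P') ≤ Module.length R (N' ⧸ P') :=
    length_le_length_restrictScalars_aux (A := R) (M := N' ⧸ P') R'
  have h2 : Module.length R (N' ⧸ P') = Module.length R (N ⧸ LinearMap.ker φ) :=
    (LinearMap.quotKerEquivOfSurjective φ hsurj).symm.length_eq
  have h3 := length_quotient_eq_add_aux (A := R) (M := N) hPker
  have h4 : 1 ≤ Module.length R ((LinearMap.ker φ).map P.mkQ) := by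
    have hne : (⟨P.mkQ ⟨n₁, hn₁N⟩, Submodule.mem_map_of_mem hn₁ker⟩ :
        (LinearMap.ker φ).map P.mkQ) ≠ 0 := by
      intro h
      have h' := congrArg Subtype.val h
      simp only [Submodule.mkQ_apply, ZeroMemClass.coe_zero,
        Submodule.Quotient.mk_eq_zero] at h'
      exact hn₁P h'
    haveI : Nontrivial ((LinearMap.ker φ).map P.mkQ) := ⟨⟨_, 0, hne⟩⟩
    exact Order.one_le_iff_pos.mpr Module.length_pos
  -- assemble: `δ(R) = a + b` with `a ≥ 1`, `δ(R') ≤ b`, `δ(R) < ∞`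
  set a := Module.length R ((LinearMap.ker φ).map P.mkQ) with ha
  set b := Module.length R (N ⧸ LinearMap.ker φ) with hb
  have hδ : Module.length R (N ⧸ P) = a + b := h3
  have hbtop : b ≠ ⊤ := by
    intro hbt; apply hfin; rw [hδ, hbt, add_top]
  have hblt : b < Module.length R (N ⧸ P) := by
    rw [hδ, add_comm]
    have h5 : b + 1 ≤ b + a := by gcongr
    exact (ENat.add_one_le_iff hbtop).mp h5
  calc Module.length R' (N' ⧸ P') ≤ Module.length R (N' ⧸ P') := h1
    _ = b := h2
    _ < Module.length R (N ⧸ P) := hblt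

end QuadraticTransform

end Literature.AlgebraicGeometry.Resolution

end
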